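import Summits.QuantumAdvantage.QuantumAdvantage.Theorems.CharDialPartyDialH1

/-!
# PartyDial (decomp-qadv lens-5 g35), part H2 — §7b–c: blind selection from fan-in (isBlind_of_fanIn), fanInLawK (every k, fan-in ≈ n^{1−1/k}/2k), pieces BlindFrobOdd / PolyFanInFrobOdd PROVED, FrobHardOdd iff DeepFrobOdd k

See part A (`CharDialPartyDialA`) for the node header; memo `NODE-g35.md` (g35 folder of decomp-qadv-lens-5).
-/

set_option autoImplicit false
set_option linter.dupNamespace false

namespace Summit.QuantumAdvantage.QuantumAdvantage.Theorems.PartyDial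

open Finset
open Summit.QuantumAdvantage.AdviceFreeQNC0

/-! ### §7b  Selection: FAN-IN `ℓ` with `(n+1)(ℓ+1)^k < (n/2k)^k` ⟹ `k`-blind ⟹ `≤ (1 - 4^{-k})·2ⁿ` -/

section BlindSel

variable {n : ℕ}

/-- pair index of slot `j` for the choice `x`: the `j`-th range of `M` adjacent pairs, offset `x j`. -/
def qIdx {k M : ℕ} (x : Fin k → Fin M) (j : Fin k) : ℕ := j.val * M + (x j).val

/-- the chosen pair index of range `j` lies below `k·M`. -/
theorem qIdx_lt {k M : ℕ} (x : Fin k → Fin M) (j : Fin k) : qIdx x j + 1 ≤ k * M := by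
  unfold qIdx
  have h1 : (x j).val + 1 ≤ M := (x j).isLt
  have h2 : (j.val + 1) * M ≤ k * M := Nat.mul_le_mul_right M j.isLt
  nlinarith

/-- different ranges get different pair indices. -/
theorem qIdx_inj {k M : ℕ} (x : Fin k → Fin M) {j j' : Fin k} (h : qIdx x j = qIdx x j') : j = j' := by
  unfold qIdx at h
  by_contra hne
  rcases lt_or_gt_of_ne hne with hlt | hlt
  · have h2 : (j.val + 1) * M ≤ j'.val * M := Nat.mul_le_mul_right M hlt
    have h1 : (x j).val < M := (x j).isLt
    nlinarith
  · have h2 : (j'.val + 1) * M ≤ j.val * M := Nat.mul_le_mul_right M hlt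
    have h1 : (x j').val < M := (x j').isLt
    nlinarith

/-- the choice vector is determined by its pair indices. -/
theorem qIdx_inj_x {k M : ℕ} {x x' : Fin k → Fin M} (h : ∀ j, qIdx x j = qIdx x' j) : x = x' := by
  funext j
  have := h j
  unfold qIdx at this
  exact Fin.ext (by omega)

/-- ★★ **Blind selection by counting**: if every cut reads at most `ℓ` bits and `(n+1)(ℓ+1)^k < (n/2k)^k`,
the strategy is `k`-blind.  [Split the `n/2` adjacent pairs `{2q, 2q+1}` into `k` ranges of `M = n/2k` and
pick one pair per range; the choice is bad for cut `g` only if each picked pair is read by `g` or is the pair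
split by `g` — at most `(ℓ+1)^k` choices per cut, `(n+1)(ℓ+1)^k < M^k` in all.] -/
theorem isBlind_of_fanIn {ℓ k : ℕ} {y : Fin (n + 1) → (Fin n → Bool) → Bool} (hy : FanIn ℓ y)
    (hcnt : (n + 1) * (ℓ + 1) ^ k < (n / (2 * k)) ^ k) : IsBlind k y := by
  classical
  set M := n / (2 * k) with hM
  have hMn : 2 * k * M ≤ n := Nat.mul_div_le n (2 * k)
  choose R hR using hy
  -- read pair indices of cut `g`, plus the pair it splits
  set A : Fin (n + 1) → Finset ℕ := fun g => insert (g.val / 2) ((R g).image fun i : Fin n => i.val / 2)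
    with hA
  have hAcard : ∀ g, (A g).card ≤ ℓ + 1 := fun g =>
    (Finset.card_insert_le _ _).trans (Nat.succ_le_succ (Finset.card_image_le.trans (hR g).1))
  -- bad choices for cut `g`
  set X : Fin (n + 1) → Finset (Fin k → Fin M) := fun g => univ.filter fun x => ∀ j, qIdx x j ∈ A g with hX
  have hXcard : ∀ g, (X g).card ≤ (ℓ + 1) ^ k := by
    intro g
    let ψ : ↥(X g) → (Fin k → ↥(A g)) := fun x j => ⟨qIdx x.1 j, (mem_filter.1 x.2).2 j⟩
    have hψ : Function.Injective ψ := by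
      intro x x' h
      refine Subtype.ext (qIdx_inj_x fun j => ?_)
      have := congrFun h j
      simpa [ψ] using congrArg Subtype.val this
    have h1 := Fintype.card_le_of_injective ψ hψ
    rw [Fintype.card_coe, Fintype.card_fun, Fintype.card_coe, Fintype.card_fin] at h1
    exact h1.trans (Nat.pow_le_pow_left (hAcard g) k)
  -- a good choice exists
  set bad : Finset (Fin k → Fin M) := univ.filter fun x => ∃ g, x ∈ X g with hbad
  have hbadcard : bad.card ≤ (n + 1) * (ℓ + 1) ^ k := by
    calc bad.card ≤ ((univ : Finset (Fin (n + 1))).biUnion X).card := by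
          refine card_le_card fun x hx => ?_
          obtain ⟨g, hg⟩ := (mem_filter.1 hx).2
          exact mem_biUnion.2 ⟨g, mem_univ g, hg⟩
      _ ≤ ∑ g : Fin (n + 1), (X g).card := card_biUnion_le
      _ ≤ ∑ _g : Fin (n + 1), (ℓ + 1) ^ k := sum_le_sum fun g _ => hXcard g
      _ = (n + 1) * (ℓ + 1) ^ k := by simp
  have huniv : (univ : Finset (Fin k → Fin M)).card = M ^ k := by
    rw [Finset.card_univ, Fintype.card_fun, Fintype.card_fin, Fintype.card_fin]
  obtain ⟨x, -, hx⟩ := Finset.exists_mem_notMem_of_card_lt_card (s := bad) (t := univ)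
    (by rw [huniv]; exact lt_of_le_of_lt hbadcard hcnt)
  have hMn' : 2 * (k * M) ≤ n := by rw [← mul_assoc]; exact hMn
  -- the pairs
  refine ⟨fun j => 2 * qIdx x j, fun j => 2 * qIdx x j + 1, ⟨?_, ?_, ?_⟩, ?_, ?_⟩
  · intro j j' h
    have h' : 2 * qIdx x j = 2 * qIdx x j' := h
    exact qIdx_inj x (by omega)
  · intro j j' h
    have h' : 2 * qIdx x j + 1 = 2 * qIdx x j' + 1 := h
    exact qIdx_inj x (by omega)
  · intro j j'
    show 2 * qIdx x j ≠ 2 * qIdx x j' + 1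
    omega
  · intro j
    show 2 * qIdx x j < n ∧ 2 * qIdx x j + 1 < n
    have := qIdx_lt x j
    constructor <;> omega
  · intro g
    have hxg : x ∉ X g := fun h => hx (mem_filter.2 ⟨mem_univ x, g, h⟩)
    have hxg' : ¬ ∀ j, qIdx x j ∈ A g := fun h => hxg (mem_filter.2 ⟨mem_univ x, h⟩)
    push Not at hxg'
    obtain ⟨j, hj⟩ := hxg'
    have hj1 : qIdx x j ≠ g.val / 2 := fun h => hj (by rw [hA]; exact mem_insert.2 (Or.inl h))
    have hj2 : ∀ i ∈ R g, i.val / 2 ≠ qIdx x j := fun i hi h =>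
      hj (by rw [hA]; exact mem_insert.2 (Or.inr (mem_image.2 ⟨i, hi, h⟩)))
    refine ⟨j, ?_, fun u v huv => (hR g).2 u v fun i hi => huv i ?_ ?_⟩
    · show 2 * qIdx x j < g.val ↔ 2 * qIdx x j + 1 < g.val
      constructor <;> intro h <;> omega
    · show i.val ≠ 2 * qIdx x j
      have := hj2 i hi; omega
    · show i.val ≠ 2 * qIdx x j + 1
      have := hj2 i hi; omega

/-- ★★ **FAN-IN LAW, every `k`**: fan-in `ℓ` with `(n+1)(ℓ+1)^k < (n/2k)^k` ⟹ `#WIN ≤ (1 - 4^{-k})·2ⁿ`,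
every charge — any wiring, any positions, degree hypothesis unused.  (`k = 2`: `ℓ ≲ √n/4`; `k = 3`:
`ℓ ≲ n^{2/3}/7`; fixed `k`: `ℓ ≲ n^{1-1/k}/2k`.) -/
theorem fanInLawK {ℓ k : ℕ} (hcnt : (n + 1) * (ℓ + 1) ^ k < (n / (2 * k)) ^ k) (c : ℕ)
    (y : Fin (n + 1) → (Fin n → Bool) → Bool) (hy : FanIn ℓ y) :
    ((univ.filter fun u : Fin n → Bool => ringWinU c y u = true).card : ℝ) ≤
      (1 - (1 / 4 : ℝ) ^ k) * (2 : ℝ) ^ n :=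
  blind_law c y (isBlind_of_fanIn hy hcnt)

/-- contrapositive: a strategy that is not `k`-blind has a cut of fan-in `> ℓ` whenever
`(n+1)(ℓ+1)^k < (n/2k)^k`. -/
theorem not_fanIn_of_not_blind {ℓ k : ℕ} {y : Fin (n + 1) → (Fin n → Bool) → Bool}
    (hy : ¬ IsBlind k y) (hcnt : (n + 1) * (ℓ + 1) ^ k < (n / (2 * k)) ^ k) : ¬ FanIn ℓ y :=
  fun h => hy (isBlind_of_fanIn h hcnt)

/-- pair-separated with segments `≥ 2` (§6) ⟹ `2`-blind: any two points of each segment form the pairs. -/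
theorem isBlind_of_isPairLocal {y : Fin (n + 1) → (Fin n → Bool) → Bool} (hy : IsPairLocal 2 y) :
    IsBlind 2 y := by
  obtain ⟨B, sg, pty, hsg, hpty, hns, hloc, hsize⟩ := hy
  obtain ⟨a₀, ha₀, b₀, hb₀, hab₀⟩ := Finset.one_lt_card.1 (lt_of_lt_of_le one_lt_two (hsize 0 (by norm_num)))
  obtain ⟨a₁, ha₁, b₁, hb₁, hab₁⟩ := Finset.one_lt_card.1 (lt_of_lt_of_le one_lt_two (hsize 1 (by norm_num)))
  simp only [mem_filter, mem_univ, true_and] at ha₀ hb₀ ha₁ hb₁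
  have hv : ∀ {i i' : Fin n}, i.val = i'.val → i = i' := fun h => Fin.ext h
  refine ⟨![a₀.val, a₁.val], ![b₀.val, b₁.val], ⟨?_, ?_, ?_⟩, ?_, ?_⟩
  · intro j j' h
    fin_cases j <;> fin_cases j'
    · rfl
    · exact absurd (hv (by simpa using h)) fun e => by rw [e] at ha₀; omega
    · exact absurd (hv (by simpa using h)) fun e => by rw [e] at ha₁; omega
    · rfl
  · intro j j' h
    fin_cases j <;> fin_cases j'
    · rfl
    · exact absurd (hv (by simpa using h)) fun e => by rw [e] at hb₀; omega
    · exact absurd (hv (by simpa using h)) fun e => by rw [e] at hb₁; omega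
    · rfl
  · intro j j' h
    fin_cases j <;> fin_cases j'
    · exact hab₀ (hv (by simpa using h))
    · exact absurd (hv (by simpa using h)) fun e => by rw [e] at ha₀; omega
    · exact absurd (hv (by simpa using h)) fun e => by rw [e] at ha₁; omega
    · exact hab₁ (hv (by simpa using h))
  · intro j
    fin_cases j
    · exact ⟨a₀.isLt, b₀.isLt⟩
    · exact ⟨a₁.isLt, b₁.isLt⟩
  · intro g
    have hpg := hpty g
    -- the blind pair is the OTHER segment's
    by_cases hp0 : pty g = 0
    · refine ⟨1, ?_, fun u v huv => hloc g u v fun i hi => ?_⟩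
      · have := hns a₁ b₁ g ha₁.1 hb₁.1 (by rw [ha₁.2, hp0]; norm_num) (by rw [ha₁.2, hb₁.2])
        simpa using this
      · refine huv i ?_ ?_
        · simp only [Matrix.cons_val_one, Matrix.cons_val_fin_one]
          intro h; have e := hv h; rw [e] at hi
          rcases hi with hi | hi
          · exact ha₁.1 hi
          · rw [ha₁.2, hp0] at hi; norm_num at hi
        · simp only [Matrix.cons_val_one, Matrix.cons_val_fin_one]
          intro h; have e := hv h; rw [e] at hi
          rcases hi with hi | hi
          · exact hb₁.1 hi
          · rw [hb₁.2, hp0] at hi; norm_num at hi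
    · have hp1 : pty g = 1 := by omega
      refine ⟨0, ?_, fun u v huv => hloc g u v fun i hi => ?_⟩
      · have := hns a₀ b₀ g ha₀.1 hb₀.1 (by rw [ha₀.2, hp1]; norm_num) (by rw [ha₀.2, hb₀.2])
        simpa using this
      · refine huv i ?_ ?_
        · simp only [Matrix.cons_val_zero]
          intro h; have e := hv h; rw [e] at hi
          rcases hi with hi | hi
          · exact ha₀.1 hi
          · rw [ha₀.2, hp1] at hi; norm_num at hi
        · simp only [Matrix.cons_val_zero]
          intro h; have e := hv h; rw [e] at hi
          rcases hi with hi | hi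
          · exact hb₀.1 hi
          · rw [hb₀.2, hp1] at hi; norm_num at hi

end BlindSel

/-! ### §7c  Pieces after §7: the blind / fan-in-`n^{1-1/k}` sector PROVED; residual `DeepFrobOdd k` -/

section BlindPieces

/-- piece (A‴ₖ), the `k`-BLIND sector: `FrobHardOdd` restricted to `k`-blind strategies (there are `k`
disjoint pairs of coordinates, every cut blind to one of them and not splitting it).  [PROVED for every `n`
and every `k` with `θ = 1 - 4^{-k}`, degree hypothesis unused: `blindFrobOdd_holds`; WEAKER than T] -/
def BlindFrobOdd (k : ℕ) : Prop :=
  ∀ (p : ℕ) [Fact p.Prime], 5 ≤ p → ∃ θ : ℝ, θ < 1 ∧ ∃ n₀ : ℕ, ∀ n ≥ n₀, ∀ c : ℕ,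
    ∀ y : Fin (n + 1) → (Fin n → Bool) → Bool, (∀ g, HasDegF p (y g) (p - 1)) → IsBlind k y →
      ((univ.filter fun u : Fin n → Bool => ringWinU c y u = true).card : ℝ) ≤ θ * (2 : ℝ) ^ n

/-- piece (Lₖ), the POLYNOMIAL FAN-IN sector: `FrobHardOdd` restricted to strategies of fan-in `ℓ`, for every
`ℓ` with `(n+1)(ℓ+1)^k < (n/2k)^k` (so `ℓ` up to `≈ n^{1-1/k}/2k`).  [PROVED for every `n`, `k` with
`θ = 1 - 4^{-k}`, degree hypothesis unused: `polyFanInFrobOdd_holds`; WEAKER than T] -/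
def PolyFanInFrobOdd (k : ℕ) : Prop :=
  ∀ (p : ℕ) [Fact p.Prime], 5 ≤ p → ∃ θ : ℝ, θ < 1 ∧ ∃ n₀ : ℕ, ∀ n ≥ n₀, ∀ c ℓ : ℕ,
    (n + 1) * (ℓ + 1) ^ k < (n / (2 * k)) ^ k →
    ∀ y : Fin (n + 1) → (Fin n → Bool) → Bool, (∀ g, HasDegF p (y g) (p - 1)) → FanIn ℓ y →
      ((univ.filter fun u : Fin n → Bool => ringWinU c y u = true).card : ℝ) ≤ θ * (2 : ℝ) ^ n

/-- piece (B‴ₖ), the DEEP residual: `FrobHardOdd` restricted to degree-`(p−1)` strategies that are NOT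
`k`-blind — for every `k` disjoint pairs some cut depends on, or splits, each of them; in particular
(`not_fanIn_of_not_blind`) some cut has fan-in `> ℓ` for every `ℓ` with `(n+1)(ℓ+1)^k < (n/2k)^k`.
[T-implied; UNDECIDED; `⟺ FrobHardOdd` for every `k`: `frobHardOdd_iff_deep`; for `k = 2` implied by the §6
residual: `deepFrobOdd_two_of_knotted`.  The degree hypothesis must bite here: without it, strategies with a
few cuts reading everything win with probability `→ 1`.] -/
def DeepFrobOdd (k : ℕ) : Prop :=
  ∀ (p : ℕ) [Fact p.Prime], 5 ≤ p → ∃ θ : ℝ, θ < 1 ∧ ∃ n₀ : ℕ, ∀ n ≥ n₀, ∀ c : ℕ,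
    ∀ y : Fin (n + 1) → (Fin n → Bool) → Bool, (∀ g, HasDegF p (y g) (p - 1)) → ¬ IsBlind k y →
      ((univ.filter fun u : Fin n → Bool => ringWinU c y u = true).card : ℝ) ≤ θ * (2 : ℝ) ^ n

/-- `(1/4)^k > 0`. -/
theorem quarter_pow_pos (k : ℕ) : (0 : ℝ) < (1 / 4 : ℝ) ^ k := by positivity

/-- piece (A‴ₖ) holds outright, every `k`. -/
theorem blindFrobOdd_holds (k : ℕ) : BlindFrobOdd k := by
  intro p _ _
  refine ⟨1 - (1 / 4 : ℝ) ^ k, by linarith [quarter_pow_pos k], 0, fun n _ c y _ hy => ?_⟩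
  exact blind_law c y hy

/-- piece (Lₖ) holds outright, every `k`. -/
theorem polyFanInFrobOdd_holds (k : ℕ) : PolyFanInFrobOdd k := by
  intro p _ _
  refine ⟨1 - (1 / 4 : ℝ) ^ k, by linarith [quarter_pow_pos k], 0, fun n _ c ℓ hℓ y _ hy => ?_⟩
  exact fanInLawK hℓ c y hy

/-- T ⟹ (B‴ₖ) (projection). -/
theorem deepFrobOdd_of_frobHardOdd (k : ℕ)
    (hT : Summit.QuantumAdvantage.QuantumAdvantage.Theses.CharDial.FrobHardOdd) : DeepFrobOdd k := by
  intro p _ hp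
  obtain ⟨θ, hθ, n₀, h⟩ := hT p hp
  exact ⟨θ, hθ, n₀, fun n hn c y hy _ => h n hn c y hy⟩

/-- ★★★ item 32598 from its DEEP residual alone, every `k`. -/
theorem frobHardOdd_of_deep (k : ℕ) (hB : DeepFrobOdd k) :
    Summit.QuantumAdvantage.QuantumAdvantage.Theses.CharDial.FrobHardOdd := by
  intro p _ hp
  obtain ⟨θ₂, hθ₂, n₂, h₂⟩ := hB p hp
  refine ⟨max (1 - (1 / 4 : ℝ) ^ k) θ₂, max_lt (by linarith [quarter_pow_pos k]) hθ₂, n₂,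
    fun n hn c y hy => ?_⟩
  have h2 : (0 : ℝ) ≤ (2 : ℝ) ^ n := by positivity
  by_cases hS : IsBlind k y
  · exact (blind_law c y hS).trans (mul_le_mul_of_nonneg_right (le_max_left _ _) h2)
  · exact (h₂ n hn c y hy hS).trans (mul_le_mul_of_nonneg_right (le_max_right _ _) h2)

/-- **The dial on T after §7**: `FrobHardOdd ⟺ DeepFrobOdd k`, every `k` (the `k`-blind / fan-in-`n^{1-1/k}`
sector is decided). -/
theorem frobHardOdd_iff_deep (k : ℕ) :
    Summit.QuantumAdvantage.QuantumAdvantage.Theses.CharDial.FrobHardOdd ↔ DeepFrobOdd k :=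
  ⟨deepFrobOdd_of_frobHardOdd k, frobHardOdd_of_deep k⟩

/-- (B″) ⟹ (B‴₂): the §6 residual implies the §7 residual at `k = 2` (`¬ 2-blind ⊆ ¬ pair-separated`). -/
theorem deepFrobOdd_two_of_knotted (hB : KnottedFrobOdd) : DeepFrobOdd 2 := by
  intro p _ hp
  obtain ⟨θ, hθ, n₀, h⟩ := hB p hp
  exact ⟨θ, hθ, n₀, fun n hn c y hy hS => h n hn c y hy fun hS' => hS (isBlind_of_isPairLocal hS')⟩

/-- (B‴ₖ) ⟹ (B″) (through T). -/
theorem knottedFrobOdd_of_deep (k : ℕ) (hB : DeepFrobOdd k) : KnottedFrobOdd :=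
  knottedFrobOdd_of_frobHardOdd (frobHardOdd_of_deep k hB)

end BlindPieces

end Summit.QuantumAdvantage.QuantumAdvantage.Theorems.PartyDial
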